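import Literature.NumberTheory.EllipticCurves.ModularJacobianNeronDifferentialsTame
import Literature.NumberTheory.EllipticCurves.NewformCuspFourierValuation
import HarnessLib

/-!
# The cusp criterion for the Néron lattice `L = H⁰(𝒥₀(N)_{ℤ_(p)}, Ω¹)` of `J₀(N)`
# (Česnavičius–Neururer–Saha, JEMS 26 (2024), Prop. 5.14 with Prop. 6.2 and Thm. 6.12), in the
# vocabulary of the carrier `TameNeronFormsAt`

Topic `NumberTheory/EllipticCurves`; namespace `Literature.NumberTheory.EllipticCurves.ModularForms`.
Wanted by the pen `bsd-idea-3` (g12), route `TameQuarticManinParity` of the BSD summit, LINE 42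
(«Néron congruence saturation»): its print-level support `CuspRegularFormsMemTameNeronLattice`
("cusp-regular rational forms lie in the tame Néron lattice", consumed by the proved glue
`N42 → LP42 → E41`) is the specialisation `(p, e) = (3, 8)`, `v₃(N) = 2` of the fact below
(`cuspRegularForms_mem_tameNeronLattice_three`). Nothing in this file proves any case of the Manin
conjecture or of BSD.

## The source (held: the authors' final version, `paper:url-57bab272877a`, 51 pp.)

K. Česnavičius, M. Neururer, A. Saha, *The Manin constant and the modular degree*, J. Eur. Math.
Soc. 26 (2024) 573–637 [CesnaviciusNeururerSaha2023].

* **Prop. 5.14** (p. 39), verbatim: "For a prime `p` and a cuspform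
  `f ∈ H⁰(X₀(N)_{ℚ̄_p}, ω^{⊗2}(−cusps))`, the differential `ω_f ∈ H⁰(X₀(N)_{ℚ̄_p}, Ω¹)` lies in the
  `ℤ̄_p`-lattice `H⁰(X₀(N)_{ℤ̄_p}, Ω) ≅ H⁰(𝒳₀(N)_{ℤ̄_p}, Ω)` (see (5.4.1)) if and only if for every
  `0 ≤ ℓ ≤ val_p(N)` and some (equivalently, any) cusp `𝔠 ∈ X₀(N)(ℚ̄_p)` whose denominator `L`
  satisfies `ℓ = val_p(L)` and some (equivalently, any) isomorphism `ι : ℚ̄_p ≃ ℂ`, we have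
  `val_p(ι(f)|ι(𝔠)) ≥ { −val_p(N) if val_p(L) = 0;  −val_p(N/L) + 1/(p−1) if 0 < val_p(L) < val_p(N);
  0 if val_p(L) = val_p(N) }` (5.14.1). For such an `f` defined over a number field `K` with ring of
  integers `O_K`, we have `ω_f ∈ H⁰(X₀(N)_{O_K}, Ω)` if and only if (5.14.1) holds for all primes `p`
  and all embeddings `K ↪ ℚ̄_p`." Here (Lemma 5.13, pp. 38–39, and (4.2.2), p. 29)
  `val_p(f|𝔠) := inf_{n ≥ 0} val_p(a_f(n;γ))` for any `γ ∈ SL₂(ℤ)` with `𝔠 = γ∞`, the `a_f(n;γ)` being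
  the coefficients of `f|₂γ` in the parameter `e^{2πiz/w(𝔠)}` — the tree's `fourierCoeffAtCusp N 2 f γ n`
  (`NewformCuspFourierValuation.lean`, whose module docstring fixes this dictionary, `‖·‖` the
  spectral norm of `ℚ̄_p = PadicAlgCl p`, `val_p(x) ≥ B ⟺ ‖x‖ ≤ p^{−B}`).
* **§5.5** (p. 35): `H⁰(X₀(N)_ℂ, ω^{⊗2}(−cusps))` "is canonically identified with the `ℂ`-vector space
  of … cuspforms of weight `2`" on `Γ₀(N)`, and a cuspform "over a scheme `S`" means an element of
  `H⁰(X₀(N)_S, ω^{⊗2}(−cusps))`; over `S = Spec ℚ` these are the cusp forms with RATIONAL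
  `q`-expansion at `∞` (the `q`-expansion principle, [DiamondIm1995] Thm. 12.3.7, as used in the tree's
  `IntegralCuspForms.lean`).
* **Prop. 6.2** (p. 41) with **Example 6.3** (p. 42: "Proposition 6.2 applies to `R = ℤ_(p)` and
  `X = (X_Γ)_{ℤ_(p)}` for every prime `p`"): "the map `Pic⁰_{X/R} → 𝒥⁰` is an isomorphism if and only
  if the inclusion `H⁰(𝒥, Ω¹) ↪ H⁰(X, Ω)` is an equality inside `H⁰(J, Ω¹) ≅ H⁰(X_K, Ω¹)` (6.2.1),
  which happens if and only if `X` has rational singularities".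
* **Thm. 6.12** (p. 46): "For a prime `p`, the modular curve `X₀(N)_{ℤ_(p)}` has rational
  singularities whenever (a) `p ≥ 5`; or (b) `p = 3` and either `val_p(N) ≤ 2` or there is a prime
  `p' ∣ N` with `p' ≡ 2 mod 3`; or (c) `p = 2` and either `val_p(N) ≤ 2` or there is a prime `p' ∣ N`
  with `p' ≡ 3 mod 4`."

Consequently, under the hypothesis of Thm. 6.12, for a weight-`2` cusp form `g` on `Γ₀(N)`:
`g ∈ L := H⁰(𝒥₀(N)_{ℤ_(p)}, Ω¹)` (read in `S₂(Γ₀(N))` through `H⁰(𝒥, Ω¹) ⊂ H⁰(J₀(N)_ℚ, Ω¹) ≅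
H⁰(X₀(N)_ℚ, Ω¹)` and the `q`-expansion at `∞`, exactly as the field `TameNeronFormsAt.lattice` is
documented) **if and only if** `g` has rational `q`-expansion at `∞` and satisfies (5.14.1) at `p` at
every cusp: (⇐) `g` is a cuspform over `ℚ` (§5.5), `ω_g ∈ H⁰(X₀(N)_{ℤ_(p)}, Ω)` by Prop. 5.14 (the
`ℤ_(p)`-points of the finite free `ℤ`-lattice `H⁰(X₀(N), Ω)` are cut out inside `H⁰(X₀(N)_ℚ, Ω¹)` by
the `ℤ̄_p`-lattice, first lines of the proof on p. 40), `= H⁰(𝒥₀(N)_{ℤ_(p)}, Ω¹)` by (6.2.1) and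
Thm. 6.12; (⇒) `L ⊂ H⁰(X₀(N)_ℚ, Ω¹)` consists of `ℚ`-rational forms, and `L = H⁰(X₀(N)_{ℤ_(p)}, Ω)`
gives (5.14.1) by Prop. 5.14.

## What this file provides

* `cesnaviciusNeururerSahaIntegralityBound p v_L v_N` — the brace of (5.14.1) (`1/(p−1)` if
  `0 < v_L < v_N`, else `0`), next to the tree's Cor-4.7 brace `cesnaviciusNeururerSahaCuspBound`;
  PROVED: `0 ≤` both braces and `IntegralityBound ≤ CuspBound` (each of the seven rows of Cor. 4.7
  dominates the corresponding row of (5.14.1) — the comparison made in the proof of Thm. 5.15,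
  p. 40: "This, however, follows from Corollary 4.7"; the middle row is the tree's
  `one_div_sub_one_le_cesnaviciusNeururerSahaCuspBound`).
* `CuspIntegralAt p N g` — "`g` satisfies (5.14.1) at `p` at every cusp" (all `γ ∈ SL₂(ℤ)`, all
  `ι : ℚ̄_p ≃ ℂ`, all `n`), and `CuspRegularAt p N g` — "`g` satisfies the Cor-4.7-shaped bounds at `p`
  at every cusp" (the Literature twin, for every `p`, of the pen's route-side `CuspRegularAtThree`);
  PROVED: `CuspRegularAt → CuspIntegralAt`, and `ℤ`-combinations of newforms are cusp-regular under the
  named fact `cesnaviciusNeururerSaha_cor_4_7` (a restatement of that fact's conclusion).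
* the named fact `exists_tameNeronFormsAt_latticeCriterion` (statement only): under the hypotheses
  of the tree's `nonempty_tameNeronFormsAt` (`p` prime, `0 < e`, `p ∤ e`, Thm. 6.12's rational-singularity
  hypothesis on `(p, N)`) there is a `Λ : TameNeronFormsAt N p e` whose `lattice` is EXACTLY the set of
  weight-`2` cusp forms on `Γ₀(N)` with rational `q`-expansion at `∞` satisfying (5.14.1) at `p` at
  every cusp;
* PROVED consequences: `nonempty_tameNeronFormsAt` follows from it
  (`nonempty_tameNeronFormsAt_of_latticeCriterion` — the new fact REFINES the old one, it is not a
  second independent debt of the cone), the route's case `(3, 8)`, `v₃(N) = 2`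
  (`exists_tameNeronFormsAt_three_latticeCriterion`), and the pen's support LP42 verbatim
  (`cuspRegularForms_mem_tameNeronLattice_three`).

## HONESTY (what the named fact does and does not assert)

`TameNeronFormsAt N p e` is a HYPOTHESIS STRUCTURE: its fields are the printed properties of the
pair `(L, L_K)`, not a construction of Néron models (absent from the tree, cf. the module docstring
of `ModularJacobianNeronDifferentialsTame.lean`). The fact asserts that the TRUE pair — which
satisfies every field by the sources cited there (this is the content of `nonempty_tameNeronFormsAt`)
— has, in addition, its `ℤ_(p)`-lattice `L` cut out inside `S₂(Γ₀(N))` by Prop. 5.14's cusp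
criterion; so in the `∃ Λ` the field `lattice` is now PINNED (as a subset of `S₂(Γ₀(N))`) to the
printed `L`, while `latticeK` remains constrained only by the structure's fields. It is stated for
weight `2` and `Γ₀(N)` only (Prop. 5.14 is printed in that setting). It is NOT weaker than print in
the `⇒` direction (Prop. 5.14 is an equivalence) and adds nothing beyond print in the `⇐` direction
(Prop. 5.14 + (6.2.1) + Thm. 6.12, the same chain as the field `mem_of_span_newforms`, which is its
special case for `ℤ`-combinations of newforms via Cor. 4.7).
`-- TODO(general form): weight k and Γ₁(N) ⊂ Γ ⊂ Γ₀(N) (Thm. 5.15's second display; Prop. 5.6).`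

## References

* [CesnaviciusNeururerSaha2023] op. cit., (4.2.2) (p. 29), Cor. 4.7 (p. 31), §5.5 (p. 35), (5.4.1)
  (p. 34), Lemma 5.13 (pp. 38–39), Prop. 5.14 (p. 39), Thm. 5.15 and Rem. 5.16 (p. 40), Prop. 6.2
  (p. 41), Example 6.3 (p. 42), Thm. 6.12 and Cor. 6.14 (p. 46).
* [DiamondIm1995] F. Diamond, J. Im, *Modular forms and modular curves*, Thm. 12.3.7 (the
  `q`-expansion principle).
-/

noncomputable section

open scoped MatrixGroups ModularForm

open CongruenceSubgroup UpperHalfPlane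

namespace Literature.NumberTheory.EllipticCurves.ModularForms

/-! ### The brace of (5.14.1) and its comparison with the brace of Cor. 4.7 -/

section Bounds

/-- **The brace of ČNS Prop. 5.14, (5.14.1)**, as a function of `p`, `v_L = val_p(L)` and
`v_N = val_p(N)`, written — like the tree's `cesnaviciusNeururerSahaCuspBound` — as the summand `B`
in `val_p(f|𝔠) ≥ −val_p(N/L) + B`: `B = 1/(p−1)` if `0 < v_L < v_N`, and `B = 0` if `v_L = 0`
(bound `−val_p(N) = −val_p(N/L)`) or `v_L = v_N` (bound `0 = −val_p(N/L)`).
[cite: CesnaviciusNeururerSaha2023, Prop. 5.14 (5.14.1) (p. 39)] -/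
def cesnaviciusNeururerSahaIntegralityBound (p vL vN : ℕ) : ℝ :=
  if 0 < vL ∧ vL < vN then 1 / ((p : ℝ) - 1) else 0

/-- The middle row: `0 < v_L < v_N` gives `1/(p−1)`.
[cite: CesnaviciusNeururerSaha2023, Prop. 5.14 (5.14.1) (p. 39)] -/
theorem cesnaviciusNeururerSahaIntegralityBound_of_pos_of_lt {p vL vN : ℕ} (h0 : 0 < vL)
    (hlt : vL < vN) : cesnaviciusNeururerSahaIntegralityBound p vL vN = 1 / ((p : ℝ) - 1) := by
  unfold cesnaviciusNeururerSahaIntegralityBound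
  rw [if_pos ⟨h0, hlt⟩]

/-- The outer rows: `v_L = 0` or `v_N ≤ v_L` (for a cusp denominator `L ∣ N`: `v_L = v_N`) give `0`.
[cite: CesnaviciusNeururerSaha2023, Prop. 5.14 (5.14.1) (p. 39)] -/
theorem cesnaviciusNeururerSahaIntegralityBound_of_not {p vL vN : ℕ} (h : vL = 0 ∨ vN ≤ vL) :
    cesnaviciusNeururerSahaIntegralityBound p vL vN = 0 := by
  unfold cesnaviciusNeururerSahaIntegralityBound
  rw [if_neg]
  omega

/-- `0 ≤ B₍₅.₁₄.₁₎` (`p ≥ 1`). [cite: CesnaviciusNeururerSaha2023, Prop. 5.14 (5.14.1) (p. 39)] -/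
theorem cesnaviciusNeururerSahaIntegralityBound_nonneg {p vL vN : ℕ} (hp : 1 ≤ p) :
    0 ≤ cesnaviciusNeururerSahaIntegralityBound p vL vN := by
  unfold cesnaviciusNeururerSahaIntegralityBound
  split_ifs
  · have : (1 : ℝ) ≤ p := by exact_mod_cast hp
    exact div_nonneg zero_le_one (by linarith)
  · exact le_rfl

/-- `0 ≤ B₍Cor. 4.7₎` for a cusp denominator (`L ∣ N`, so `v_L ≤ v_N`): every row of the Cor. 4.7
brace is then non-negative (`0`, `max(1/2, 1/(p−1))`, `1`, `1 + v_N/2`, `2 + v_N/4`, `3`,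
`1 + ½ min(v_L, v_N − v_L)`). [cite: CesnaviciusNeururerSaha2023, Cor. 4.7 (p. 31)] -/
theorem cesnaviciusNeururerSahaCuspBound_nonneg {p vL vN : ℕ} (hle : vL ≤ vN) :
    0 ≤ cesnaviciusNeururerSahaCuspBound p vL vN := by
  have hN : (0 : ℝ) ≤ vN := Nat.cast_nonneg _
  have hL : (0 : ℝ) ≤ vL := Nat.cast_nonneg _
  have hle' : (vL : ℝ) ≤ vN := by exact_mod_cast hle
  unfold cesnaviciusNeururerSahaCuspBound
  split_ifs
  · exact le_rfl
  · exact le_trans (by norm_num) (le_max_left _ _)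
  · exact zero_le_one
  · linarith
  · linarith
  · norm_num
  · have hmin : (0 : ℝ) ≤ min (vL : ℝ) ((vN : ℝ) - vL) := le_min hL (sub_nonneg.mpr hle')
    linarith

/-- **Each row of Cor. 4.7 dominates the corresponding row of (5.14.1)** (`p` prime): for
`0 < v_L < v_N` this is the tree's `one_div_sub_one_le_cesnaviciusNeururerSahaCuspBound`
(`1/(p−1) ≤` rows 2–7), otherwise `0 ≤ B₍Cor. 4.7₎`. This is the comparison of the proof of Thm. 5.15
(p. 40): "by Proposition 5.14, we need to check that … the valuation … satisfies the bound (5.14.1).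
This, however, follows from Corollary 4.7."
[cite: CesnaviciusNeururerSaha2023, proof of Thm. 5.15 (p. 40); Prop. 5.14 (p. 39); Cor. 4.7 (p. 31)] -/
theorem cesnaviciusNeururerSahaIntegralityBound_le_cuspBound {p vL vN : ℕ} (hp : p.Prime)
    (hle : vL ≤ vN) :
    cesnaviciusNeururerSahaIntegralityBound p vL vN ≤ cesnaviciusNeururerSahaCuspBound p vL vN := by
  by_cases h : 0 < vL ∧ vL < vN
  · rw [cesnaviciusNeururerSahaIntegralityBound_of_pos_of_lt h.1 h.2]
    exact one_div_sub_one_le_cesnaviciusNeururerSahaCuspBound hp h.1 h.2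
  · rw [cesnaviciusNeururerSahaIntegralityBound_of_not (by omega)]
    exact cesnaviciusNeururerSahaCuspBound_nonneg hle

end Bounds

/-! ### The cusp conditions on a weight-`2` cusp form -/

section CuspConditions

variable (p : ℕ) [Fact p.Prime] (N : ℕ)

/-- **`g` satisfies the cusp criterion (5.14.1) at `p` at every cusp of `X₀(N)`**: for every
`γ ∈ SL₂(ℤ)` (cusp `𝔠 = γ∞` of denominator `L = cuspDenominator N γ`), every ring isomorphism
`ι : ℚ̄_p ≃ ℂ` and every `n`, `val_p(ι⁻¹ a_g(n;γ)) ≥ −val_p(N/L) + B₍₅.₁₄.₁₎(p, val_p L, val_p N)`,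
i.e. `‖ι⁻¹(a_g(n;γ))‖ ≤ p^{val_p(N) − val_p(L) − B}` — the right-hand side of ČNS Prop. 5.14 with
"for every `ℓ` and some (equivalently, any) cusp of denominator valuation `ℓ` and some (equivalently,
any) `ι`" rendered as ALL `γ`, ALL `ι` (and `val_p(f|𝔠) = inf_n`, (4.2.2), as ALL `n`), in the
dictionary of `NewformCuspFourierValuation.lean`.
[cite: CesnaviciusNeururerSaha2023, Prop. 5.14 (5.14.1) (p. 39); (4.2.2) (p. 29); Lemma 5.13 (pp. 38–39)] -/
def CuspIntegralAt (g : CuspForm (Gamma0 N) 2) : Prop :=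
  ∀ (γ : SL(2, ℤ)) (ι : PadicAlgCl p ≃+* ℂ) (n : ℕ),
    ‖ι.symm (fourierCoeffAtCusp N 2 ⇑g γ n)‖ ≤
      (p : ℝ) ^ (((padicValNat p N - padicValNat p (cuspDenominator N γ) : ℕ) : ℝ) -
        cesnaviciusNeururerSahaIntegralityBound p (padicValNat p (cuspDenominator N γ))
          (padicValNat p N))

/-- **`g` is cusp-regular at `p`**: it satisfies, at every cusp of `X₀(N)`, under every
`ι : ℚ̄_p ≃ ℂ` and for every `n`, the Cor-4.7-shaped bound
`‖ι⁻¹(a_g(n;γ))‖ ≤ p^{val_p(N) − val_p(L) − B₍Cor. 4.7₎(p, val_p L, val_p N)}` — the CONCLUSION of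
ČNS Cor. 4.7 (printed for `ℤ`-combinations of normalised weight-`2` newforms), as a predicate on an
arbitrary weight-`2` cusp form. (Literature twin, for every prime `p`, of the route-side
`CuspRegularAtThree` of `Summits/…/Theses/TameQuarticManinParity`, pen bsd-idea-3 LINE 42.)
[cite: CesnaviciusNeururerSaha2023, Cor. 4.7 (p. 31)] -/
def CuspRegularAt (g : CuspForm (Gamma0 N) 2) : Prop :=
  ∀ (γ : SL(2, ℤ)) (ι : PadicAlgCl p ≃+* ℂ) (n : ℕ),
    ‖ι.symm (fourierCoeffAtCusp N 2 ⇑g γ n)‖ ≤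
      (p : ℝ) ^ (((padicValNat p N - padicValNat p (cuspDenominator N γ) : ℕ) : ℝ) -
        cesnaviciusNeururerSahaCuspBound p (padicValNat p (cuspDenominator N γ)) (padicValNat p N))

variable {p N}

/-- Unfolding `CuspIntegralAt`. [cite: CesnaviciusNeururerSaha2023, Prop. 5.14 (5.14.1) (p. 39)] -/
theorem cuspIntegralAt_iff (g : CuspForm (Gamma0 N) 2) :
    CuspIntegralAt p N g ↔ ∀ (γ : SL(2, ℤ)) (ι : PadicAlgCl p ≃+* ℂ) (n : ℕ),
      ‖ι.symm (fourierCoeffAtCusp N 2 ⇑g γ n)‖ ≤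
        (p : ℝ) ^ (((padicValNat p N - padicValNat p (cuspDenominator N γ) : ℕ) : ℝ) -
          cesnaviciusNeururerSahaIntegralityBound p (padicValNat p (cuspDenominator N γ))
            (padicValNat p N)) :=
  Iff.rfl

/-- Unfolding `CuspRegularAt`. [cite: CesnaviciusNeururerSaha2023, Cor. 4.7 (p. 31)] -/
theorem cuspRegularAt_iff (g : CuspForm (Gamma0 N) 2) :
    CuspRegularAt p N g ↔ ∀ (γ : SL(2, ℤ)) (ι : PadicAlgCl p ≃+* ℂ) (n : ℕ),
      ‖ι.symm (fourierCoeffAtCusp N 2 ⇑g γ n)‖ ≤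
        (p : ℝ) ^ (((padicValNat p N - padicValNat p (cuspDenominator N γ) : ℕ) : ℝ) -
          cesnaviciusNeururerSahaCuspBound p (padicValNat p (cuspDenominator N γ))
            (padicValNat p N)) :=
  Iff.rfl

/-- `val_p(L) ≤ val_p(N)` for the denominator `L = cuspDenominator N γ ∣ N` of a cusp (`N ≥ 1`).
[cite: CesnaviciusNeururerSaha2023, §4.1 (p. 28)] -/
theorem padicValNat_cuspDenominator_le [NeZero N] (γ : SL(2, ℤ)) :
    padicValNat p (cuspDenominator N γ) ≤ padicValNat p N :=
  (padicValNat_dvd_iff_le (NeZero.ne N)).mp (pow_padicValNat_dvd.trans (cuspDenominator_dvd N γ))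

/-- **Cusp-regular ⇒ the cusp criterion (5.14.1)** (the Cor. 4.7 brace dominates the (5.14.1) brace
row by row, and `B ↦ p^{v − B}` is antitone as `p ≥ 1`).
[cite: CesnaviciusNeururerSaha2023, proof of Thm. 5.15 (p. 40); Prop. 5.14 (p. 39); Cor. 4.7 (p. 31)] -/
theorem CuspRegularAt.cuspIntegralAt [NeZero N] {g : CuspForm (Gamma0 N) 2}
    (h : CuspRegularAt p N g) : CuspIntegralAt p N g := fun γ ι n ↦ by
  refine (h γ ι n).trans (Real.rpow_le_rpow_of_exponent_le ?_ ?_)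
  · exact_mod_cast (Fact.out : p.Prime).one_lt.le
  · linarith [cesnaviciusNeururerSahaIntegralityBound_le_cuspBound (Fact.out : p.Prime)
      (padicValNat_cuspDenominator_le (p := p) (N := N) γ)]

/-- **`ℤ`-combinations of normalised weight-`2` newforms on `Γ₀(N)` are cusp-regular at every `p`**
— the conclusion of the named fact `cesnaviciusNeururerSaha_cor_4_7` (restated as the predicate).
[cite: CesnaviciusNeururerSaha2023, Cor. 4.7 (p. 31)] -/
theorem cuspRegularAt_of_mem_span_newforms (h47 : cesnaviciusNeururerSaha_cor_4_7) [NeZero N]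
    {g : CuspForm (Gamma0 N) 2} (hg : g ∈ Submodule.span ℤ (newforms0 N 2)) :
    CuspRegularAt p N g :=
  fun γ ι n ↦ h47 N p g hg γ ι n

/-- Hence such combinations satisfy the cusp criterion (5.14.1) at every `p` (proof of Thm. 5.15).
[cite: CesnaviciusNeururerSaha2023, Thm. 5.15 and its proof (p. 40)] -/
theorem cuspIntegralAt_of_mem_span_newforms (h47 : cesnaviciusNeururerSaha_cor_4_7) [NeZero N]
    {g : CuspForm (Gamma0 N) 2} (hg : g ∈ Submodule.span ℤ (newforms0 N 2)) :
    CuspIntegralAt p N g :=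
  (cuspRegularAt_of_mem_span_newforms h47 hg).cuspIntegralAt

/-- The Fourier coefficients of the zero function vanish at every cusp (private helper). [folklore] -/
private theorem fourierCoeffAtCusp_zero (k : ℤ) (γ : SL(2, ℤ)) (n : ℕ) :
    fourierCoeffAtCusp N k (0 : ℍ → ℂ) γ n = 0 := by
  simp [fourierCoeffAtCusp, SlashAction.zero_slash, qExpansion_zero]

/-- Non-vacuity: the zero cusp form — the empty `ℤ`-combination of newforms, so an instance of
Cor. 4.7 as printed — is cusp-regular at every `p` (all its coefficients vanish).
[cite: CesnaviciusNeururerSaha2023, Cor. 4.7 (p. 31)] -/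
theorem cuspRegularAt_zero : CuspRegularAt p N (0 : CuspForm (Gamma0 N) 2) := fun γ ι n ↦ by
  rw [CuspForm.coe_zero, fourierCoeffAtCusp_zero, map_zero, norm_zero]
  exact Real.rpow_nonneg (Nat.cast_nonneg p) _

/-- Non-vacuity: the zero cusp form satisfies the cusp criterion (5.14.1) at every `p`
(`0 ∈ H⁰(X₀(N)_{ℤ_p}, Ω)`). [cite: CesnaviciusNeururerSaha2023, Prop. 5.14 (5.14.1) (p. 39)] -/
theorem cuspIntegralAt_zero : CuspIntegralAt p N (0 : CuspForm (Gamma0 N) 2) := fun γ ι n ↦ by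
  rw [CuspForm.coe_zero, fourierCoeffAtCusp_zero, map_zero, norm_zero]
  exact Real.rpow_nonneg (Nat.cast_nonneg p) _

end CuspConditions

/-! ### The named fact: Prop. 5.14 + (6.2.1) + Thm. 6.12 in the carrier `TameNeronFormsAt` -/

/-- **Česnavičius–Neururer–Saha, Prop. 5.14 with Prop. 6.2 / Example 6.3 and Thm. 6.12: the Néron
lattice `L = H⁰(𝒥₀(N)_{ℤ_(p)}, Ω¹)` is cut out in `S₂(Γ₀(N))` by the cusp criterion (5.14.1)**
(named fact, statement only; a refinement of the construction fact `nonempty_tameNeronFormsAt`, which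
it implies: `nonempty_tameNeronFormsAt_of_latticeCriterion`). For every `N ≥ 1`, every prime `p`,
every `e ≥ 1` with `p ∤ e`, such that `X₀(N)_{ℤ_(p)}` has rational singularities by Thm. 6.12 —
`p ≥ 5`; or `p = 3` and (`v₃(N) ≤ 2` or some prime `p' ∣ N` has `p' ≡ 2 mod 3`); or `p = 2` and
(`v₂(N) ≤ 2` or some prime `p' ∣ N` has `p' ≡ 3 mod 4`) — the pair `(L, L_K)` of Néron cotangent
lattices of `J₀(N)` over `ℤ_(p) ⊂ ℤ_(p)[ϖ]`, read in `S₂(Γ₀(N))`, has all the properties listed in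
`TameNeronFormsAt N p e` (the content of `nonempty_tameNeronFormsAt`, sources cited there) AND `L`
consists EXACTLY of the weight-`2` cusp forms `g` on `Γ₀(N)` with rational `q`-expansion at `∞`
(`g ∈ H⁰(X₀(N)_ℚ, ω^{⊗2}(−cusps))`, §5.5) that satisfy (5.14.1) at `p` at every cusp
(`CuspIntegralAt p N g`): "`ω_f … lies in the … lattice `H⁰(X₀(N)_{ℤ̄_p}, Ω)` … if and only if for every
`0 ≤ ℓ ≤ val_p(N)` and some (equivalently, any) cusp `𝔠` whose denominator `L` satisfies `ℓ = val_p(L)`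
and some (equivalently, any) isomorphism `ι : ℚ̄_p ≃ ℂ`, we have `val_p(ι(f)|ι(𝔠)) ≥ {−val_p(N) if
val_p(L) = 0; −val_p(N/L) + 1/(p−1) if 0 < val_p(L) < val_p(N); 0 if val_p(L) = val_p(N)}`"
(Prop. 5.14), and `H⁰(X₀(N)_{ℤ_(p)}, Ω) = H⁰(𝒥₀(N)_{ℤ_(p)}, Ω¹)` ((6.2.1), Example 6.3, Thm. 6.12).
See the module docstring for the two-line derivation of each direction and the HONESTY paragraph
(weight `2`, `Γ₀(N)`; `lattice` pinned, `latticeK` not).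
`-- TODO(general form): weight k, Γ₁(N) ⊂ Γ ⊂ Γ₀(N); the number-field version (all p, all K ↪ ℚ̄_p).`
[cite: CesnaviciusNeururerSaha2023, Prop. 5.14 (p. 39); Lemma 5.13 (pp. 38–39); (4.2.2) (p. 29); §5.5 (p. 35); Prop. 6.2 (6.2.1) (p. 41); Example 6.3 (p. 42); Thm. 6.12 (p. 46)]
[cite: DiamondIm1995, Thm. 12.3.7] -/
def exists_tameNeronFormsAt_latticeCriterion : Prop :=
  ∀ (N : ℕ) [NeZero N] (p e : ℕ) [Fact p.Prime], 0 < e → ¬ p ∣ e →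
    (5 ≤ p ∨
      (p = 3 ∧ (padicValNat 3 N ≤ 2 ∨ ∃ p' : ℕ, p'.Prime ∧ p' ∣ N ∧ p' % 3 = 2)) ∨
      (p = 2 ∧ (padicValNat 2 N ≤ 2 ∨ ∃ p' : ℕ, p'.Prime ∧ p' ∣ N ∧ p' % 4 = 3))) →
    ∃ Λ : TameNeronFormsAt N p e, ∀ g : CuspForm (Gamma0 N) 2,
      g ∈ Λ.lattice ↔ (∀ n : ℕ, ∃ q : ℚ, (q : ℂ) = cuspCoeff g n) ∧ CuspIntegralAt p N g

/-! ### Proved consequences -/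

/-- The new fact refines `nonempty_tameNeronFormsAt` (same hypotheses, the `∃ Λ` forgets the
criterion). [cite: CesnaviciusNeururerSaha2023, Thm. 6.12 (p. 46)] -/
theorem nonempty_tameNeronFormsAt_of_latticeCriterion (h : exists_tameNeronFormsAt_latticeCriterion) :
    nonempty_tameNeronFormsAt := by
  intro N _ p e hp he hpe hyp
  haveI : Fact p.Prime := ⟨hp⟩
  obtain ⟨Λ, -⟩ := h N p e he hpe hyp
  exact ⟨Λ⟩

/-- **The case of the route TameQuarticManinParity**: `p = 3`, `e = 8`, `v₃(N) = 2` (`N = 9M`,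
`3 ∤ M`; Thm. 6.12 (b)): some `Λ : TameNeronFormsAt N 3 8` has `lattice` = the rational cusp forms
satisfying (5.14.1) at `3` at every cusp.
[cite: CesnaviciusNeururerSaha2023, Prop. 5.14 (p. 39); Thm. 6.12 (b) (p. 46)] -/
theorem exists_tameNeronFormsAt_three_latticeCriterion (h : exists_tameNeronFormsAt_latticeCriterion)
    (N : ℕ) [NeZero N] (hN : padicValNat 3 N = 2) :
    ∃ Λ : TameNeronFormsAt N 3 8, ∀ g : CuspForm (Gamma0 N) 2,
      g ∈ Λ.lattice ↔ (∀ n : ℕ, ∃ q : ℚ, (q : ℂ) = cuspCoeff g n) ∧ CuspIntegralAt 3 N g :=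
  h N 3 8 (by norm_num) (by norm_num) (Or.inr (Or.inl ⟨rfl, Or.inl hN.le⟩))

/-- **Cusp-regular rational forms lie in the tame Néron lattice** (`p = 3`, `e = 8`, `v₃(N) = 2`) —
the pen's support `CuspRegularFormsMemTameNeronLattice` (route TameQuarticManinParity, LINE 42, LP42)
VERBATIM, from the named fact: the Cor-4.7-shaped bounds imply (5.14.1)
(`CuspRegularAt.cuspIntegralAt`), and (5.14.1) with a rational `q`-expansion is membership in `L`.
[cite: CesnaviciusNeururerSaha2023, Prop. 5.14 (p. 39); proof of Thm. 5.15 (p. 40); Prop. 6.2 (p. 41); Thm. 6.12 (b) (p. 46)] -/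
theorem cuspRegularForms_mem_tameNeronLattice_three (h : exists_tameNeronFormsAt_latticeCriterion) :
    ∀ (N : ℕ) [NeZero N], padicValNat 3 N = 2 →
      ∃ Λ : TameNeronFormsAt N 3 8, ∀ g : CuspForm (Gamma0 N) 2,
        (∀ n : ℕ, ∃ q : ℚ, (q : ℂ) = cuspCoeff g n) →
        (∀ (γ : SL(2, ℤ)) (ι : PadicAlgCl 3 ≃+* ℂ) (n : ℕ),
          ‖ι.symm (fourierCoeffAtCusp N 2 ⇑g γ n)‖ ≤
            (3 : ℝ) ^ (((padicValNat 3 N - padicValNat 3 (cuspDenominator N γ) : ℕ) : ℝ) -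
              cesnaviciusNeururerSahaCuspBound 3 (padicValNat 3 (cuspDenominator N γ))
                (padicValNat 3 N))) →
        g ∈ Λ.lattice := by
  intro N _ hN
  obtain ⟨Λ, hΛ⟩ := exists_tameNeronFormsAt_three_latticeCriterion h N hN
  refine ⟨Λ, fun g hq hreg ↦ (hΛ g).mpr ⟨hq, ?_⟩⟩
  have hreg' : CuspRegularAt 3 N g := fun γ ι n ↦ by exact_mod_cast hreg γ ι n
  exact hreg'.cuspIntegralAt

/-- Conversely (the `⇒` direction of Prop. 5.14, unpacked): under the fact, every element of the
produced `Λ.lattice` has a rational `q`-expansion and satisfies (5.14.1) at `p` at every cusp.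
[cite: CesnaviciusNeururerSaha2023, Prop. 5.14 (p. 39)] -/
theorem exists_tameNeronFormsAt_forall_mem_cuspIntegralAt
    (h : exists_tameNeronFormsAt_latticeCriterion) (N : ℕ) [NeZero N] (p e : ℕ) [Fact p.Prime]
    (he : 0 < e) (hpe : ¬ p ∣ e)
    (hyp : 5 ≤ p ∨
      (p = 3 ∧ (padicValNat 3 N ≤ 2 ∨ ∃ p' : ℕ, p'.Prime ∧ p' ∣ N ∧ p' % 3 = 2)) ∨
      (p = 2 ∧ (padicValNat 2 N ≤ 2 ∨ ∃ p' : ℕ, p'.Prime ∧ p' ∣ N ∧ p' % 4 = 3))) :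
    ∃ Λ : TameNeronFormsAt N p e, ∀ g ∈ Λ.lattice,
      (∀ n : ℕ, ∃ q : ℚ, (q : ℂ) = cuspCoeff g n) ∧ CuspIntegralAt p N g := by
  obtain ⟨Λ, hΛ⟩ := h N p e he hpe hyp
  exact ⟨Λ, fun g hg ↦ (hΛ g).mp hg⟩

/-! ### At `p = 3`, `v₃(N) = 2` the two braces coincide: the lattice is cut out EXACTLY by the
Cor-4.7-shaped bounds (appended 2026-08-29, typer g35) -/

section Three

/-- At `p = 3`, `v₃(N) = 2` the brace of (5.14.1) and the brace of Cor. 4.7 COINCIDE in every row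
(`v_L = 0`: `0 = 0`; `v_L = 1`: `1/(3−1) = 1/2 = max(1/2, 1/(3−1))`; `v_L = 2`: `0 = 0`) — Example 4.8 /
Table 4.8.1 (p. 31): the Cor. 4.7 rows are sharp.
[cite: CesnaviciusNeururerSaha2023, Prop. 5.14 (5.14.1) (p. 39); Cor. 4.7 and Example 4.8 (p. 31)] -/
theorem cesnaviciusNeururerSahaIntegralityBound_three_eq_cuspBound {vL vN : ℕ} (hN : vN = 2)
    (hle : vL ≤ vN) :
    cesnaviciusNeururerSahaIntegralityBound 3 vL vN = cesnaviciusNeururerSahaCuspBound 3 vL vN := by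
  subst hN
  unfold cesnaviciusNeururerSahaIntegralityBound cesnaviciusNeururerSahaCuspBound
  interval_cases vL <;> norm_num

/-- Hence at a level with `v₃(N) = 2`: **cusp-regular at `3` ⟺ the cusp criterion (5.14.1) at `3`**.
[cite: CesnaviciusNeururerSaha2023, Prop. 5.14 (p. 39); Cor. 4.7 (p. 31)] -/
theorem cuspRegularAt_three_iff_cuspIntegralAt {N : ℕ} [NeZero N] (hN : padicValNat 3 N = 2)
    (g : CuspForm (Gamma0 N) 2) : CuspRegularAt 3 N g ↔ CuspIntegralAt 3 N g := by
  refine forall₃_congr fun γ ι n ↦ ?_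
  rw [cesnaviciusNeururerSahaIntegralityBound_three_eq_cuspBound hN
    (padicValNat_cuspDenominator_le (p := 3) γ)]

/-- **At `v₃(N) = 2` the tame Néron lattice is EXACTLY the set of cusp-regular rational forms** (under
the named fact): some `Λ : TameNeronFormsAt N 3 8` has
`Λ.lattice = {g | rational q-expansion at ∞ ∧ CuspRegularAt 3 N g}` — the pen's reading "cusp-regular
cuts out `L`" (LINE 42) as a theorem modulo `exists_tameNeronFormsAt_latticeCriterion`.
[cite: CesnaviciusNeururerSaha2023, Prop. 5.14 (p. 39); Cor. 4.7 (p. 31); Prop. 6.2 (p. 41); Thm. 6.12 (b) (p. 46)] -/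
theorem exists_tameNeronFormsAt_three_mem_lattice_iff_cuspRegularAt
    (h : exists_tameNeronFormsAt_latticeCriterion) (N : ℕ) [NeZero N] (hN : padicValNat 3 N = 2) :
    ∃ Λ : TameNeronFormsAt N 3 8, ∀ g : CuspForm (Gamma0 N) 2,
      g ∈ Λ.lattice ↔ (∀ n : ℕ, ∃ q : ℚ, (q : ℂ) = cuspCoeff g n) ∧ CuspRegularAt 3 N g := by
  obtain ⟨Λ, hΛ⟩ := exists_tameNeronFormsAt_three_latticeCriterion h N hN
  exact ⟨Λ, fun g ↦ by rw [hΛ g, cuspRegularAt_three_iff_cuspIntegralAt hN g]⟩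

end Three

end Literature.NumberTheory.EllipticCurves.ModularForms

end
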